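import Summits.Langlands.Langlands.Theses.HolomorphicShadow
import Literature.NumberTheory.GaloisRepresentations.DirichletCharacterOfGaloisCharacter
import Literature.NumberTheory.GaloisRepresentations.ArtinReciprocityCharacterProofs
import Literature.NumberTheory.GaloisRepresentations.ResidualPairIntegrality
import Literature.NumberTheory.GaloisRepresentations.EvenGaloisRep
import Literature.NumberTheory.GaloisRepresentations.ArtinLFunctionEulerFactorProofs
import HarnessLib

/-!
# Route `HolomorphicShadow` — crux `SectorComplement` (stmt-Langlands-14623), line `pieces`, stub B⁺
# (`stub_evenArtinPlaneOfMaass`), piece P₁: the Artin data of an even `σ : Γ_ℚ → GL₂(ℂ)` — PROVED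

Stub B⁺ of `Cruxes/SectorComplement/Lines/pieces.lean` (the even Artin plane of Fontaine–Mazur–
Langlands from the even-Maass slice `H`) factors, in the strategist's card
(`Lines/birth_HolomorphicShadow_EvenArtinPlaneOfMaass.lean`), through four pieces P₁–P₄.  P₁ is
VERBATIM the route's support item `EvenArtinShadowData` (stmt-Langlands-13896): every
`σ : Γ_ℚ →ₜ* GL₂(ℂ)` with `det σ(c) = 1` at complex conjugations carries an ADMISSIBLE ARTIN DATUM
`(N, χ, ε, a)` — a level `N > 0`, a Dirichlet character `χ` mod `N`, a sign `ε = ±1` with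
`σ(c) = ε · 1` at every complex conjugation, and a polynomially bounded `a : ℕ → ℂ` Euler-pinned to
`σ` away from `N` (`a₁ = 1`, multiplicative, `a_{p^{j+1}} = 0` for `p ∣ N`, the Hecke recursion
`a_{p^{j+2}} = a_p a_{p^{j+1}} - χ(p) a_{p^j}` and `det(X - σ(Frob_v)) = X² - a_p X + χ(p)` with `σ`
unramified at `v ∣ p`, for every prime `p ∤ N`).  This is the datum at which the hypothesis `H`
(even strong Artin over `ℚ` in Maass-form form) is evaluated in `EvenArtinPlaneOfMaass_of`.

This file PROVES P₁ unconditionally (`evenArtinShadowData`), assembling tree theorems: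

* `σ` has open kernel (`FramedArtinRep.isOpen_ker_toMonoidHom`: `Γ_ℚ` profinite, `GL₂(ℂ)` has no
  small subgroups), hence finite image and bounded traces (`exists_norm_trace_le`), and is
  unramified outside a finite set `S` of places (`FramedArtinRep.eventually_isUnramifiedAt`);
* `det ∘ σ` is `χ₀ ∘ χ_m` for a Dirichlet character `χ₀` mod `m` — Kronecker–Weber, PROVED in the
  tree (`exists_dirichletCharacter_eq_dirichletGaloisCharacter`), with `det σ(Frob_p) = χ₀(p)` for
  `p ∤ m` (`FramedRep.coe_dirichletGaloisCharacter_of_isArithFrobAt`, Artin's convention);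
* complex conjugations of `Γ_ℚ` are conjugate (`IsComplexConjugation.isConj`) and act on an even
  rank-two `σ` by `±1` (`FramedGaloisRep.isEven_iff_eq_one_or_eq_neg_one`), whence ONE sign `ε`
  (`exists_sign_of_isEven`);
* `N := m · ∏_{v ∈ S} p_v`, `χ := χ₀` raised to level `N`; `a_n := ∏_{p^k ∥ n} c_p(k)` with
  `c_p = 0` in positive degree for `p ∣ N` and `c_p` the solution of the Hecke recursion
  `u_{k+2} = t_p u_{k+1} - χ(p) u_k`, `u₀ = 1`, `u₁ = t_p := tr σ(Frob_p)` for `p ∤ N` (Mathlib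
  `LinearRecurrence.mkSol`); the Frobenius polynomial at `v ∣ p` is `X² - tr · X + det`
  (`Matrix.charpoly_fin_two`, `FramedGaloisRep.IsUnramifiedAt.hasFrobCharpolyAt_charpoly`), and
  `‖a_n‖ ≤ (n+1)^A` with `2^A ≥ T + 1 ≥ ‖t_p‖ + 1` (`norm_le_pow_of_heckeRecursion`,
  `norm_factorization_prod_le`: `∏ B^{k_p} ≤ ∏ (p^{k_p})^A = n^A`).

With P₃ landed (`HolomorphicShadow.complexToLAdicTransport_evenArtinPlane`, p794940) stub B⁺ is now
reduced to P₂ (the Maass-eigenform dictionary with L-algebraicity: classical `Γ₀(L)`-automorphic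
Maass form of eigenvalue `1/4` with Euler-pinned coefficients ⇒ cuspidal L-algebraic `P` on
`GL₂(𝔸_ℚ)` with matching Satake parameters — no carrier in the tree) and P₄ (transport of the
plane statement along `K ≃+* ℚ`).  HONEST STATUS: unconditional and sorry-free; it is one piece of
one stub of an open-problem crux (`SectorComplement` = Langlands minus the even-Maass slice) and the
statement of the route item stmt-Langlands-13896 by name; it proves reciprocity for nothing.

References: [SerreAbelianLadic1968] Ch. I §§1.1, 2.1, 2.3; [DiamondShurman2005] §9.2, §5.9;
[DeligneSerreASENS1974] §4.4; [Washington1997] Ch. 3; [Booker2003] p. 1090.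
-/

noncomputable section

set_option linter.dupNamespace false -- project-wide option; `Summit.Langlands.Langlands` is the mandated namespace

open scoped NumberField
open Filter IsDedekindDomain Polynomial Field NumberField
open Literature.NumberTheory.GaloisRepresentations
open Rat.HeightOneSpectrum

namespace Summit.Langlands.Langlands.Theorems.HolomorphicShadow.EvenArtinData

/-! ### 1. The Hecke recursion at one prime -/

/-- **Geometric bound for the Hecke recursion**: if `u₀ = 1`, `u₁ = t`,
`u_{k+2} = t u_{k+1} - d u_k` with `‖t‖ + 1 ≤ B` and `‖d‖ ≤ 1`, then `‖u_k‖ ≤ B ^ k` (induction: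
`‖u_{k+2}‖ ≤ (B - 1) B^{k+1} + B^k ≤ B^{k+2}` since `1 ≤ B`).  These `u_k` are the coefficients of
`(1 - t T + d T²)⁻¹`. [cite: DiamondShurman2005, §5.9 (the recursion for `a_{p^r}`)] -/
theorem norm_le_pow_of_heckeRecursion {t d : ℂ} {B : ℝ} (u : ℕ → ℂ) (h0 : u 0 = 1) (h1 : u 1 = t)
    (hrec : ∀ k, u (k + 2) = t * u (k + 1) - d * u k) (ht : ‖t‖ + 1 ≤ B) (hd : ‖d‖ ≤ 1) (k : ℕ) :
    ‖u k‖ ≤ B ^ k := by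
  have hB : 1 ≤ B := le_trans (le_add_of_nonneg_left (norm_nonneg t)) ht
  -- two-step induction
  suffices h : ‖u k‖ ≤ B ^ k ∧ ‖u (k + 1)‖ ≤ B ^ (k + 1) from h.1
  induction k with
  | zero =>
    refine ⟨by rw [h0, norm_one, pow_zero], ?_⟩
    rw [zero_add, h1, pow_one]
    linarith [norm_nonneg t]
  | succ k ih =>
    refine ⟨ih.2, ?_⟩
    rw [hrec]
    have h1 := ih.1
    have h2 := ih.2
    have hBk : B ^ k ≤ B ^ (k + 1) := by
      rw [pow_succ]
      exact le_mul_of_one_le_right (pow_nonneg (by linarith) k) hB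
    calc ‖t * u (k + 1) - d * u k‖
        ≤ ‖t‖ * ‖u (k + 1)‖ + ‖d‖ * ‖u k‖ := by
          refine (norm_sub_le _ _).trans ?_
          rw [norm_mul, norm_mul]
      _ ≤ (B - 1) * B ^ (k + 1) + 1 * B ^ (k + 1) := by
          gcongr
          · linarith
          · exact h1.trans hBk
      _ = B ^ (k + 1 + 1) := by ring

/-- **The Hecke recursion as a Mathlib `LinearRecurrence`**: the solution `u = mkSol ![1, t]` of
`u_{k+2} = -d u_k + t u_{k+1}` has `u₀ = 1`, `u₁ = t` and `u_{k+2} = t u_{k+1} - d u_k`. [folklore] -/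
theorem mkSol_heckeRecurrence (t d : ℂ) :
    (⟨2, ![-d, t]⟩ : LinearRecurrence ℂ).mkSol ![1, t] 0 = 1 ∧
      (⟨2, ![-d, t]⟩ : LinearRecurrence ℂ).mkSol ![1, t] 1 = t ∧
      ∀ k : ℕ, (⟨2, ![-d, t]⟩ : LinearRecurrence ℂ).mkSol ![1, t] (k + 2) =
        t * (⟨2, ![-d, t]⟩ : LinearRecurrence ℂ).mkSol ![1, t] (k + 1) -
          d * (⟨2, ![-d, t]⟩ : LinearRecurrence ℂ).mkSol ![1, t] k := by
  refine ⟨?_, ?_, fun k => ?_⟩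
  · exact (⟨2, ![-d, t]⟩ : LinearRecurrence ℂ).mkSol_eq_init ![1, t] ⟨0, (two_pos : (0 : ℕ) < 2)⟩
  · exact (⟨2, ![-d, t]⟩ : LinearRecurrence ℂ).mkSol_eq_init ![1, t] ⟨1, (one_lt_two : (1 : ℕ) < 2)⟩
  · have h : (⟨2, ![-d, t]⟩ : LinearRecurrence ℂ).mkSol ![1, t] (k + 2) =
        ∑ i : Fin 2, ![-d, t] i * (⟨2, ![-d, t]⟩ : LinearRecurrence ℂ).mkSol ![1, t] (k + (i : ℕ)) :=
      (⟨2, ![-d, t]⟩ : LinearRecurrence ℂ).is_sol_mkSol ![1, t] k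
    rw [h, Fin.sum_univ_two]
    simp only [Matrix.cons_val_zero, Matrix.cons_val_one, Fin.val_zero, Fin.val_one, add_zero]
    ring

/-! ### 2. Multiplicative sequences from local data -/

/-- **Multiplicativity** of `n ↦ ∏_{p^k ∥ n} c p k` on coprime arguments (the factorizations have
disjoint supports; the same construction as the tree's `ArtinRep.dirichletCoeff`). [folklore] -/
theorem factorization_prod_mul_of_coprime (c : ℕ → ℕ → ℂ) {m n : ℕ} (hmn : m.Coprime n) :
    (m * n).factorization.prod c = m.factorization.prod c * n.factorization.prod c := by
  rw [Nat.factorization_mul_of_coprime hmn, Finsupp.prod_add_index_of_disjoint]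
  rw [Nat.support_factorization, Nat.support_factorization]
  exact hmn.disjoint_primeFactors

/-- **Prime powers**: `∏_{q^k ∥ p^k} c q k = c p k` provided `c p 0 = 1`. [folklore] -/
theorem factorization_prod_prime_pow (c : ℕ → ℕ → ℂ) {p : ℕ} (hp : p.Prime) (hc : c p 0 = 1)
    (k : ℕ) : (p ^ k).factorization.prod c = c p k := by
  rw [hp.factorization_pow, Finsupp.prod_single_index hc]

/-- **Divisor-type bound**: if `‖c p k‖ ≤ B ^ k` at every prime `p` and `0 ≤ B ≤ 2 ^ A`, then
`‖∏_{p^k ∥ n} c p k‖ ≤ n ^ A` for `n ≠ 0` (indeed `∏ B^{k_p} ≤ ∏ (2^{k_p})^A ≤ ∏ (p^{k_p})^A = n^A`).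
[folklore] -/
theorem norm_factorization_prod_le (c : ℕ → ℕ → ℂ) {B : ℝ} {A : ℕ} (hB : 0 ≤ B) (hBA : B ≤ 2 ^ A)
    (hc : ∀ p : ℕ, p.Prime → ∀ k : ℕ, ‖c p k‖ ≤ B ^ k) {n : ℕ} (hn : n ≠ 0) :
    ‖n.factorization.prod c‖ ≤ (n : ℝ) ^ A := by
  rw [Finsupp.prod]
  refine (Finset.norm_prod_le _ _).trans ?_
  -- `n ^ A = ∏ (p ^ k_p) ^ A`
  have hprod : ((n : ℝ)) ^ A = ∏ p ∈ n.factorization.support, ((p : ℝ) ^ (n.factorization p)) ^ A := by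
    rw [Finset.prod_pow]
    congr 1
    conv_lhs => rw [← Nat.prod_factorization_pow_eq_self hn]
    rw [Finsupp.prod, Nat.cast_prod]
    simp
  rw [hprod]
  refine Finset.prod_le_prod (fun p _ => norm_nonneg _) fun p hp => ?_
  have hpp : p.Prime := Nat.prime_of_mem_primeFactors (by rwa [Nat.support_factorization] at hp)
  calc ‖c p (n.factorization p)‖ ≤ B ^ (n.factorization p) := hc p hpp _
    _ ≤ (2 ^ A) ^ (n.factorization p) := by gcongr
    _ = ((2 : ℝ) ^ (n.factorization p)) ^ A := by rw [← pow_mul, ← pow_mul, mul_comm]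
    _ ≤ ((p : ℝ) ^ (n.factorization p)) ^ A := by
        gcongr
        exact_mod_cast hpp.two_le

/-! ### 3. The Artin data of an even `σ : Γ_ℚ → GL₂(ℂ)` -/

/-- **Complex conjugations act through one sign on an even rank-two representation of `Γ_ℚ`.**
For `σ : Γ_ℚ →ₜ* GL₂(ℂ)` with `det σ(c) = 1` at every complex conjugation `c` there is
`ε ∈ {1, -1}` with `σ(c) = ε · 1` for EVERY complex conjugation `c` (attached to any `φ : ℚ →+* ℝ`):
each `σ(c)` is `±1` (`FramedGaloisRep.isEven_iff_eq_one_or_eq_neg_one`: the involutions of `SL₂(ℂ)`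
are `±1`), all complex conjugations of `Γ_ℚ` are conjugate (`IsComplexConjugation.isConj`, the real
embedding of `ℚ` being unique), and `±1` is central. [cite: Booker2003, p. 1090] -/
theorem exists_sign_of_isEven (σ : FramedGaloisRep ℚ ℂ 2)
    (heven : ∀ (φ : ℚ →+* ℝ) (c : absoluteGaloisGroup ℚ), IsComplexConjugation φ c →
      Matrix.GeneralLinearGroup.det (σ c) = 1) :
    ∃ ε : ℂ, (ε = 1 ∨ ε = -1) ∧ ∀ (φ : ℚ →+* ℝ) (c : absoluteGaloisGroup ℚ),
      IsComplexConjugation φ c →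
        ((σ c : GL (Fin 2) ℂ) : Matrix (Fin 2) (Fin 2) ℂ) = ε • (1 : Matrix (Fin 2) (Fin 2) ℂ) := by
  have hsign := (FramedGaloisRep.isEven_iff_eq_one_or_eq_neg_one (K := ℚ) (A := ℂ) two_ne_zero σ).mp
    heven
  obtain ⟨c₀, hc₀⟩ := exists_isComplexConjugation (Rat.castHom ℝ)
  -- every complex conjugation acts as `σ c₀`
  have hall : ∀ (φ : ℚ →+* ℝ) (c : absoluteGaloisGroup ℚ), IsComplexConjugation φ c → σ c = σ c₀ := by
    intro φ c hc
    obtain rfl : φ = Rat.castHom ℝ := Subsingleton.elim _ _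
    obtain ⟨g, hg⟩ := isConj_iff.mp (hc₀.isConj hc)
    rw [← hg, map_mul, map_mul, map_inv]
    rcases hsign _ c₀ hc₀ with h | h
    · rw [h, mul_one, mul_inv_cancel]
    · rw [h, mul_neg, mul_one, neg_mul, mul_inv_cancel]
  rcases hsign _ c₀ hc₀ with h | h
  · refine ⟨1, Or.inl rfl, fun φ c hc => ?_⟩
    rw [hall φ c hc, h, one_smul, Units.val_one]
  · refine ⟨-1, Or.inr rfl, fun φ c hc => ?_⟩
    rw [hall φ c hc, h, Units.val_neg, Units.val_one, neg_one_smul]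

/-- **An Artin representation of `ℚ` has bounded Frobenius traces**: `σ(Γ_ℚ)` is finite (open
kernel, `FramedArtinRep.isOpen_ker_toMonoidHom`, in the compact `Γ_ℚ`), so `‖tr σ(g)‖ ≤ T` for
one `T` and all `g`. [cite: SerreAbelianLadic1968, Ch. I §1.1 Remark] -/
theorem exists_norm_trace_le (σ : FramedGaloisRep ℚ ℂ 2) :
    ∃ T : ℝ, 0 ≤ T ∧ ∀ g : absoluteGaloisGroup ℚ,
      ‖((σ g : GL (Fin 2) ℂ) : Matrix (Fin 2) (Fin 2) ℂ).trace‖ ≤ T := by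
  have hker : IsOpen (σ.toMonoidHom.ker : Set (absoluteGaloisGroup ℚ)) :=
    FramedArtinRep.isOpen_ker_toMonoidHom σ
  have hfin : (Set.range fun g : absoluteGaloisGroup ℚ => σ g).Finite := by
    haveI : Finite (absoluteGaloisGroup ℚ ⧸ σ.toMonoidHom.ker) :=
      Subgroup.quotient_finite_of_isOpen _ hker
    refine (Set.finite_range fun q : absoluteGaloisGroup ℚ ⧸ σ.toMonoidHom.ker =>
      QuotientGroup.kerLift σ.toMonoidHom q).subset ?_
    rintro _ ⟨g, rfl⟩
    exact ⟨(g : absoluteGaloisGroup ℚ ⧸ σ.toMonoidHom.ker), QuotientGroup.kerLift_mk σ.toMonoidHom g⟩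
  obtain ⟨T, hT⟩ :=
    (hfin.image fun M : GL (Fin 2) ℂ => ‖(M : Matrix (Fin 2) (Fin 2) ℂ).trace‖).bddAbove
  have hT' : ∀ g : absoluteGaloisGroup ℚ, ‖((σ g : GL (Fin 2) ℂ) : Matrix (Fin 2) (Fin 2) ℂ).trace‖ ≤ T :=
    fun g => hT ⟨σ g, ⟨g, rfl⟩, rfl⟩
  exact ⟨T, (norm_nonneg _).trans (hT' 1), hT'⟩

/-- **Piece P₁ of stub B⁺ — the route's support `EvenArtinShadowData` (stmt-Langlands-13896),
PROVED.**  Every `σ : Γ_ℚ →ₜ* GL₂(ℂ)` with `det σ(c) = 1` at complex conjugations (irreducibility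
is not used) carries an admissible Artin datum `(N, χ, ε, a)`: `N > 0`, a Dirichlet character `χ`
mod `N`, a sign `ε` with `σ(c) = ε · 1` at every complex conjugation, and a polynomially bounded
`a : ℕ → ℂ`, Euler-pinned to `σ` away from `N` (`a₁ = 1`, multiplicative, `a_{p^{j+1}} = 0` for
`p ∣ N`, Hecke recursion `a_{p^{j+2}} = a_p a_{p^{j+1}} - χ(p) a_{p^j}` and
`det(X - σ(Frob_v)) = X² - a_p X + χ(p)` with `σ` unramified at the place `v ∣ p`, for `p ∤ N`).
Construction: `σ` has open kernel (`FramedArtinRep.isOpen_ker_toMonoidHom`), so `det ∘ σ` is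
`χ₀ ∘ χ_m` for a Dirichlet character `χ₀` mod `m` (Kronecker–Weber, proved in the tree:
`exists_dirichletCharacter_eq_dirichletGaloisCharacter`) with `det σ(Frob_p) = χ₀(p)` for `p ∤ m`
(`FramedRep.coe_dirichletGaloisCharacter_of_isArithFrobAt`); `σ` is unramified outside a finite set
`S` (`FramedArtinRep.eventually_isUnramifiedAt`); take `N := m · ∏_{v ∈ S} p_v`, `χ := χ₀` at
level `N`, `ε` from `exists_sign_of_isEven`, and `a` the multiplicative sequence whose `p`-part is
the Hecke recursion seeded by `tr σ(Frob_p)` and `χ(p)` for `p ∤ N` (zero for `p ∣ N`); the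
Frobenius polynomial is `X² - tr · X + det` (`Matrix.charpoly_fin_two`,
`FramedGaloisRep.IsUnramifiedAt.hasFrobCharpolyAt_charpoly`) and the bound `‖a_n‖ ≤ (n+1)^A`
comes from `‖tr σ(g)‖ ≤ T` (finite image) through `norm_le_pow_of_heckeRecursion` and
`norm_factorization_prod_le`. [cite: SerreAbelianLadic1968, Ch. I §2.3] [cite: DiamondShurman2005, §9.2]
[cite: DeligneSerreASENS1974, §4.4] -/
theorem evenArtinShadowData : Theses.HolomorphicShadow.EvenArtinShadowData := by
  intro σ _ heven
  classical
  -- (1) open kernel; bounded traces; the sign at complex conjugations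
  have hker : IsOpen (σ.toMonoidHom.ker : Set (absoluteGaloisGroup ℚ)) :=
    FramedArtinRep.isOpen_ker_toMonoidHom σ
  obtain ⟨T, hT0, hT⟩ := exists_norm_trace_le σ
  obtain ⟨ε, hε, hεc⟩ := exists_sign_of_isEven σ heven
  -- (2) the determinant character is a Dirichlet character `χ₀` mod `m` (Kronecker–Weber)
  set ψ : absoluteGaloisGroup ℚ →* ℂˣ := Matrix.GeneralLinearGroup.det.comp σ.toMonoidHom with hψ
  have hψker : IsOpen (ψ.ker : Set (absoluteGaloisGroup ℚ)) := by
    refine Subgroup.isOpen_mono (fun g hg => ?_) hker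
    rw [MonoidHom.mem_ker] at hg ⊢
    rw [hψ, MonoidHom.comp_apply, hg, map_one]
  obtain ⟨m, hm, χ₀, hχ₀⟩ := exists_dirichletCharacter_eq_dirichletGaloisCharacter ψ hψker
  -- (3) the finitely many ramified places and the level `N`
  have hS : {v : HeightOneSpectrum (𝓞 ℚ) | ¬ σ.IsUnramifiedAt v}.Finite :=
    Filter.eventually_cofinite.mp (FramedArtinRep.eventually_isUnramifiedAt σ)
  set M : ℕ := ∏ v ∈ hS.toFinset, natGenerator v with hMdef
  have hM : 0 < M := Finset.prod_pos fun v _ => (prime_natGenerator v).pos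
  have hm0 : 0 < m := Nat.pos_of_ne_zero (NeZero.ne m)
  set N : ℕ := m * M with hNdef
  have hN : 0 < N := Nat.mul_pos hm0 hM
  haveI : NeZero N := ⟨hN.ne'⟩
  have hmN : m ∣ N := dvd_mul_right m M
  set χ : DirichletCharacter ℂ N := DirichletCharacter.changeLevel hmN χ₀ with hχdef
  have hpm : ∀ p : ℕ, ¬ p ∣ N → ¬ p ∣ m := fun p hp h => hp (h.trans hmN)
  have hunr : ∀ p : ℕ, p.Prime → ¬ p ∣ N → ∀ v : HeightOneSpectrum (𝓞 ℚ),
      (p : 𝓞 ℚ) ∈ v.asIdeal → σ.IsUnramifiedAt v := by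
    intro p hp hpN v hv
    by_contra h
    have hvS : v ∈ hS.toFinset := hS.mem_toFinset.mpr h
    have hdvd : natGenerator v ∣ M := Finset.dvd_prod_of_mem _ hvS
    rw [natGenerator_eq_of_natCast_mem_asIdeal hp hv] at hdvd
    exact hpN (hdvd.trans (dvd_mul_left M m))
  have hχp : ∀ p : ℕ, p.Prime → ¬ p ∣ N → χ (p : ZMod N) = χ₀ (p : ZMod m) := by
    intro p hp hpN
    have hcop : IsCoprime (p : ℤ) (N : ℤ) :=
      Nat.isCoprime_iff_coprime.mpr ((Nat.Prime.coprime_iff_not_dvd hp).mpr hpN)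
    have h := DirichletCharacter.changeLevel_eq_cast_of_dvd' χ₀ hmN hcop
    rwa [Int.cast_natCast, Int.cast_natCast] at h
  -- (4) the place of a prime and a chosen arithmetic Frobenius there
  let vOf : ∀ p : ℕ, p.Prime → HeightOneSpectrum (𝓞 ℚ) := fun p hp =>
    (primesEquiv (R := 𝓞 ℚ)).symm ⟨p, hp⟩
  have hvOf : ∀ (p : ℕ) (hp : p.Prime), ((primesEquiv (vOf p hp) : Nat.Primes) : ℕ) = p := fun p hp => by
    simp only [vOf, Equiv.apply_symm_apply]
  have hvOf_eq : ∀ (p : ℕ) (hp : p.Prime) (v : HeightOneSpectrum (𝓞 ℚ)), (p : 𝓞 ℚ) ∈ v.asIdeal →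
      v = vOf p hp := by
    intro p hp v hv
    apply (primesEquiv (R := 𝓞 ℚ)).injective
    simp only [vOf, Equiv.apply_symm_apply]
    exact Subtype.ext (natGenerator_eq_of_natCast_mem_asIdeal hp hv)
  let frobData : ∀ p : ℕ, p.Prime → Ideal (absIntegers (𝓞 ℚ) ℚ) × absoluteGaloisGroup ℚ := fun p hp =>
    (ArtinRep.exists_mem_primesAbove_and_isArithFrobAt (K := ℚ) (vOf p hp)).choose
  have hfrob : ∀ (p : ℕ) (hp : p.Prime), (frobData p hp).1 ∈ (vOf p hp).primesAbove ∧
      IsArithFrobAt (𝓞 ℚ) (frobData p hp).2 (frobData p hp).1 := fun p hp =>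
    (ArtinRep.exists_mem_primesAbove_and_isArithFrobAt (K := ℚ) (vOf p hp)).choose_spec
  -- (5) the coefficients
  let t : ℕ → ℂ := fun p =>
    if hp : p.Prime then ((σ (frobData p hp).2 : GL (Fin 2) ℂ) : Matrix (Fin 2) (Fin 2) ℂ).trace else 0
  have ht : ∀ p : ℕ, ‖t p‖ ≤ T := by
    intro p
    by_cases hp : p.Prime
    · simp only [t, dif_pos hp]; exact hT _
    · simp only [t, dif_neg hp, norm_zero]; exact hT0
  -- the local coefficients: the Hecke recursion off `N`, zero on `N`
  let u : ℕ → ℕ → ℂ := fun p => (⟨2, ![-(χ (p : ZMod N)), t p]⟩ : LinearRecurrence ℂ).mkSol ![1, t p]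
  have hu : ∀ p : ℕ, u p 0 = 1 ∧ u p 1 = t p ∧
      ∀ k : ℕ, u p (k + 2) = t p * u p (k + 1) - χ (p : ZMod N) * u p k := fun p =>
    mkSol_heckeRecurrence (t p) (χ (p : ZMod N))
  let c : ℕ → ℕ → ℂ := fun p k => if p ∣ N then (if k = 0 then 1 else 0) else u p k
  have hc0 : ∀ p : ℕ, c p 0 = 1 := by
    intro p
    by_cases hpN : p ∣ N
    · simp only [c, if_pos hpN, if_true]
    · simp only [c, if_neg hpN]; exact (hu p).1
  -- the multiplicative sequence
  let a : ℕ → ℂ := fun n => if n = 0 then 0 else n.factorization.prod c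
  have ha0 : ∀ {n : ℕ}, n ≠ 0 → a n = n.factorization.prod c := fun hn => if_neg hn
  have hap : ∀ (p : ℕ), p.Prime → ∀ k : ℕ, a (p ^ k) = c p k := fun p hp k => by
    rw [ha0 (pow_ne_zero k hp.ne_zero), factorization_prod_prime_pow c hp (hc0 p) k]
  have ha1 : a 1 = 1 := by
    rw [ha0 one_ne_zero, Nat.factorization_one, Finsupp.prod_zero_index]
  have hamul : ∀ m n : ℕ, m.Coprime n → a (m * n) = a m * a n := by
    intro m n hmn
    rcases eq_or_ne m 0 with rfl | hm
    · simp [a]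
    rcases eq_or_ne n 0 with rfl | hn
    · simp [a]
    rw [ha0 (mul_ne_zero hm hn), ha0 hm, ha0 hn, factorization_prod_mul_of_coprime c hmn]
  -- the bound
  have hcB : ∀ p : ℕ, p.Prime → ∀ k : ℕ, ‖c p k‖ ≤ (T + 1) ^ k := by
    intro p _ k
    by_cases hpN : p ∣ N
    · by_cases hk : k = 0
      · subst hk; simp only [c, if_pos hpN, if_true, norm_one, pow_zero, le_refl]
      · simp only [c, if_pos hpN, if_neg hk, norm_zero]
        exact pow_nonneg (by linarith) k
    · simp only [c, if_neg hpN]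
      exact norm_le_pow_of_heckeRecursion (u p) (hu p).1 (hu p).2.1 (hu p).2.2 (by linarith [ht p])
        (DirichletCharacter.norm_le_one χ _) k
  obtain ⟨A, hA⟩ : ∃ A : ℕ, T + 1 ≤ (2 : ℝ) ^ A := by
    refine ⟨⌈T + 1⌉₊, (Nat.le_ceil (T + 1)).trans ?_⟩
    exact_mod_cast (Nat.lt_two_pow_self (n := ⌈T + 1⌉₊)).le
  have hbound : ∀ n : ℕ, ‖a n‖ ≤ 1 * ((n : ℝ) + 1) ^ (A : ℝ) := by
    intro n
    rw [one_mul, Real.rpow_natCast]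
    rcases eq_or_ne n 0 with rfl | hn
    · simp [a]
    rw [ha0 hn]
    refine (norm_factorization_prod_le c (by linarith) hA hcB hn).trans ?_
    gcongr
    linarith
  -- (6) assemble
  refine ⟨N, χ, ε, a, hN, hε, hεc, ⟨1, A, hbound⟩, ha1, hamul, fun p hp hpN j => ?_,
    fun p hp hpN => ⟨fun j => ?_, ?_⟩⟩
  · -- `a_{p^{j+1}} = 0` for `p ∣ N`
    rw [hap p hp]
    simp only [c, if_pos hpN, Nat.succ_ne_zero, if_false]
  · -- the Hecke recursion for `p ∤ N`
    have hp1 : a p = t p := by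
      have h := hap p hp 1
      rw [pow_one] at h
      rw [h]
      simp only [c, if_neg hpN]
      exact (hu p).2.1
    rw [hap p hp, hap p hp, hap p hp, hp1]
    simp only [c, if_neg hpN]
    exact (hu p).2.2 j
  · -- unramified at `v ∣ p` with the pinned Frobenius polynomial
    intro v hv
    have hvunr : σ.IsUnramifiedAt v := hunr p hp hpN v hv
    refine ⟨hvunr, ?_⟩
    obtain rfl := hvOf_eq p hp v hv
    have hP := hvunr.hasFrobCharpolyAt_charpoly (hfrob p hp).1 (hfrob p hp).2
    have hp1 : a p = ((σ (frobData p hp).2 : GL (Fin 2) ℂ) : Matrix (Fin 2) (Fin 2) ℂ).trace := by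
      have h := hap p hp 1
      rw [pow_one] at h
      rw [h]
      simp only [c, if_neg hpN, (hu p).2.1, t, dif_pos hp]
    have hdet : χ (p : ZMod N) = ((σ (frobData p hp).2 : GL (Fin 2) ℂ) : Matrix (Fin 2) (Fin 2) ℂ).det := by
      rw [hχp p hp hpN, ← Matrix.GeneralLinearGroup.val_det_apply]
      have h1 : ((Matrix.GeneralLinearGroup.det (σ (frobData p hp).2) : ℂˣ) : ℂ) = (ψ (frobData p hp).2 : ℂ) := by
        rw [hψ, MonoidHom.comp_apply]; rfl
      have hndvd : ¬ ((primesEquiv (vOf p hp) : Nat.Primes) : ℕ) ∣ m := by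
        rw [hvOf p hp]; exact hpm p hpN
      rw [h1, hχ₀, FramedRep.coe_dirichletGaloisCharacter_of_isArithFrobAt χ₀ (hfrob p hp).1 hndvd
        (hfrob p hp).2, hvOf p hp]
    rw [hp1, hdet, ← Matrix.charpoly_fin_two]
    exact hP

end Summit.Langlands.Langlands.Theorems.HolomorphicShadow.EvenArtinData
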